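import Literature.MathematicalPhysics.QuantumFieldTheory.Balaban1983to89.B9SupplySockB9P3ZdFrame
import Literature.MathematicalPhysics.QuantumFieldTheory.Balaban1983to89.B9SupplySockB9P3Zd
import Literature.MathematicalPhysics.QuantumFieldTheory.Balaban1983to89.B9Eq335AxialCriterion

/-!
# `Balaban1983to89.B9SupplySockB9P3ZdInstance` — [Balaban1985BackgroundPropagators] THEOREM 3.3 AT THE CONCRETE `ℤᵈ` FRAME
# `B9SupplySockB9P3ZdFrame`: the norm dictionary `B9SupplySockB9P3ZdLetters.DictGlob` PROVED, the regularity class of the frame is GENUINE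
# (U ≡ 1 regular; a regular configuration forces `0 < c·M·α₀`; gauge invariance; the cube class contains the big blocks), and the junction
# J-N06→N05 `B9SupplySockB9P3Zd.sockB9P3_allLevels_of_thm33` AT THE INSTANCE with its dictionary hypothesis DISCHARGED — the [B9] side of the
# [Balaban1985RegularSpaces] in-edge b9 is now ONE hypothesis by name, `B9.Thm33Printed c35 (geoZd 𝔸 L len) (bgZd 𝔸 L) Gp (GAZdFam 𝔸 L len ops loc)`

statement-level skeleton of published theorems with citation tags; proofs where landed; nothing here is a claim about the
Yang–Mills mass gap

PDF held: `paper:balaban1985-cmp99-background-propagators` ([4]; journal page = PDF page + 388), pp. 396–399; `paper:balaban1985-cmp99-regular-spaces-gauge-fixing`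
(B8; journal page = PDF page + 74), p. 86 (1.58)–(1.59), p. 98 («identically equal to 1 satisfies, of course, all possible regularity conditions»).

WHY THIS FILE (cell `pub-ymgap`, seat `pub-ymgap-dag-n06-e`, FAN-OUT v1.1 §N06 row s3 (α); count-neutral).  Kernel-lane companion of the definition module
`B9SupplySockB9P3ZdFrame` (the frame `geoZd ∕ bgZd ∕ GAZd` over the members `(M, i : ZdIdx d L, m)`).  n06-b's junction theorem
`sockB9P3_allLevels_of_thm33` is generic over a [B9] frame and takes the dictionary `DictGlob` as a hypothesis; here the frame is the concrete `ℤᵈ` one and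
the dictionary is a THEOREM, so dag-n05-a's b9 target «`∃ B₀ B₀β cP, … ∀ i : ZdIdx d L, ∀ m ≤ i.k, SockB9P3 …`» follows from THEOREM 3.3 BY NAME at the
instance plus n06-b's five operator binders and Prop. 6 in [4]'s shape — and nothing else of [4].

WHAT IS PROVED (kernel, 0 sorry, theorems only).
* §1 **`dictGlob_zd`**: `DictGlob (geoZd 𝔸 L len) (bgZd 𝔸 L) (GAZdFam 𝔸 L len ops loc) L memZd (ιCfgZd 𝔸 L) (ιLocZd 𝔸 L len) ops` for EVERY letter family
  `ops`, local letters `loc`, length function `len` — `(geo _).M = M` and `wNorm (−3) = |·|₍₋₃₎` by `rfl`, the γ = −3 entries n = 0, 1, 3 of (3.47) by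
  `rfl` up to the numeral identities `2 + (−3) = −1`, `1 + (−3) = −2`.
* §2 THE CLASS (3.35) OF THE FRAME IS GENUINE (n06-b's HAZARD): `reg335_bgZd_one` (U ≡ 1 is regular at every member with `M > 0`, for `c, α₀ > 0` — B8
  p. 98, r05's `reg335Zd_one`), `pos_of_reg335_bgZd` (∀-form non-degeneracy: a configuration regular at a member whose cube class is inhabited forces
  `0 < c·M·α₀` — the printed bounds are strict), `reg335_bgZd_gaugeAct` ((3.35) is a statement about the gauge orbit — n16-b's `reg335Zd_gaugeAct`
  lifted to the frame's unitary configurations, `gaugeAct_mem_unitaryUnits`), `bigBlock_mem_cubeClass396Zd` (every big `j`-block on the grid lying in `Bʲ(Λ_j)` is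
  a class cube: the class is inhabited wherever the member has level-`j` territory of big-block size), `reg335_bgZd_of_hyp133` (the member's class IS the
  second clause of B8 (1.33) in r05's `Hyp133`).
* §2b `thm33Printed_comap` ([4] Thm 3.3 as a hypothesis restricts to any re-indexed sub-family) and `thm33_zd_sep22` (the node sentence at the full `ℤᵈ`
  index implies its restriction to the [B6] (2.2)-separated members `Sep22Zd R` — the direction that holds; the located gap (b) of the frame is the converse).
* §4 (v1.1, append-only) **`reg335_bgZd_of_plaq_radii`** — NON-VACUITY BY CURVED BACKGROUNDS: n16-b's two-radii criterion
  `B9Eq335AxialCriterion.reg335Zd_of_plaq_radii` at the members (`cubeClass396Zd_family`: class cubes have scale `≤ Lᵐη` and `ℓ¹`-radius `≤ 10d⌈M⌉₊Lʲ`,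
  `l1_sub_le_of_mem_boxZd`): every unitary configuration with small curvature is in the class (3.35) of every member with `η ≤ 1`, `Lᵐη ≤ 1` — the
  hypothesis class of (γ) holds genuinely curved `U₀`.
* §3 **`sockB9P3_allLevels_of_thm33_zd`** — THE JUNCTION AT THE INSTANCE: `B9.Thm33Printed c35 (geoZd 𝔸 L len) (bgZd 𝔸 L) Gp (GAZdFam 𝔸 L len ops loc)`
  + `Prop6Feed` + `InvOnSupp` + `CurvSmall` + `LandauKills` + `AvgBound` + `HolderGlob` (all at the frame; `DictGlob` no longer a hypothesis) ⇒
  `∃ B₀ B₀β cP, 0 < B₀ ∧ 0 ≤ B₀β ∧ 0 < cP ∧ ∀ i : ZdIdx d L, ∀ m ≤ i.k, SockB9P3 L B₀ B₀β cP β len i.η m i.Ω i.Λs i.Λb` — n05-a's `SB9all` verbatim;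
  and the readings of the binders at the frame in r05's letters (`prop6Feed_zd_iff`: B8 Prop. 6 in [4]'s shape = «`U₀ ∈ 𝔄_m`, `Mα₀ ≤ c₆`, `M ≥ M₃` ⇒
  `Reg335Zd i.η L (cubeClass396Zd L (M, i, m)) (c35·M·(K₆α₀)) U₀`»).

HONEST SCOPE.  (i) What the N05 knit's b9 socket now rests on, BY NAME: [4] Theorem 3.3 at the `ℤᵈ` instance (N06's node sentence (γ) — its index ranges
over all `(M, i, m)`, located in `B9SupplySockB9P3ZdFrame` HONEST SCOPE (b)), the operator letters `ops` with n06-b's five binders ([4] Sect. A (3.10)–(3.27),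
Thm 3.11, (3.69), (3.16), Prop. 3's Hölder norm — N06's object layer (β)), and B8 Prop. 6 in [4]'s shape.  (ii) Nothing of [4] or [B8] is proved here
beyond bookkeeping; count-neutral; N05∕N06 NOT discharged; one finite lattice programme; nothing continuum ∕ ℝ⁴ ∕ OS ∕ mass-gap ∕ Clay.  Unit
`pub-ymgap-dag-n06-e` (g0), 2026-08-26.
-/

noncomputable section

open NormedSpace

namespace Literature.MathematicalPhysics.QuantumFieldTheory.Balaban1983to89.B9SupplySockB9P3ZdInstance

open B7Prop1Explicit (gaugeAct U1 e)
open B7Prop2Explicit (unitaryUnits unitaryUnits_le_U1)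
open B8Ineq132 (covDerivFwd BondTouches InAk)
open B8Eq140Level (SideTouches)
open B8ScaledSupNorm (bondNorm msup)
open B8Eq138LandauZd (covLap)
open B8LeafModelZd (ZdIdx)
open B8LeafModelZd3 (SockB9P3)
open B8Eq133Hypotheses (shiftT byDir Reg335Zd reg335Zd_iff reg335Zd_one)
open B9Eq335AxialCriterion (reg335Zd_gaugeAct)
open B9SupplySockB9P3ZdLetters (OpsZd DictGlob Prop6Feed InvOnSupp CurvSmall LandauKills AvgBound HolderGlob)
open B9SupplySockB9P3Zd (sockB9P3_allLevels_of_thm33)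
open B9SupplySockB9P3ZdFrame
open LatticeNorms (scaleLen scaleLen_pos)

-- `Site` alone could resolve to the torus sites of `Setup.lean`; re-export the `ℤ^d` sites of `B7Prop1Explicit`.
export B7Prop1Explicit (Site)

variable {d : ℕ} {𝔸 : Type} [CStarAlgebra 𝔸] {L : ℕ}

/-! ## §1 The norm dictionary is a theorem at the concrete frame -/

/-- **`DictGlob` HOLDS AT THE `ℤᵈ` FRAME** for every operator-letter family `ops`, every family of local letters `loc` and every length function `len`:
the member `(M, i, m)` has block parameter `M`; its (3.41) norm at `γ = −3` of a bond field is `|J|₍₋₃₎` (`bondNorm`); and the `γ = −3` global entries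
n = 0, 1, 3 of (3.47) for `G(U₀)` are `|G(U₀)J|₍₋₁₎` over the sides touching the `Ω_j`, `|∇^η_{U₀}G(U₀)J|₍₋₂₎`, `|Δ^η_{U₀}G(U₀)J|₍₋₃₎` — by `rfl`
and the numeral identities `2 + (−3) = −1`, `1 + (−3) = −2`. [cite: Balaban1985BackgroundPropagators, (3.41) p.397, (3.47) p.398, Thm 3.3 p.399; Balaban1985RegularSpaces, (1.59) p.86] -/
theorem dictGlob_zd (len : Site d → ℝ) (ops : ℝ → ZdIdx d L → ℕ → OpsZd d 𝔸) (loc : ∀ x : MemberZd d L, LocalLettersZd 𝔸 L x) :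
    DictGlob (geoZd 𝔸 L len) (bgZd 𝔸 L) (GAZdFam 𝔸 L len ops loc) L memZd (ιCfgZd 𝔸 L) (ιLocZd 𝔸 L len) ops := by
  intro M i m
  refine ⟨rfl, fun U₀ hU₀ J => ⟨rfl, ?_, ?_, rfl⟩⟩
  · simp only [GAZdFam, GAZd_glob_zero, memZd_M, memZd_i, memZd_m, ιCfgZd_val, ιLocZd_eq]
    norm_num
  · simp only [GAZdFam, GAZd_glob_one, memZd_M, memZd_i, memZd_m, ιCfgZd_val, ιLocZd_eq]
    norm_num

/-! ## §2 The regularity class of the frame is genuine -/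

section Genuine

variable [Nontrivial 𝔸]

/-- **`U ≡ 1` IS IN THE CLASS (3.35) OF EVERY MEMBER WITH `M > 0`**, for every `c > 0`, `α₀ > 0` (`L ≥ 1`): B8 p. 98 «The configuration … identically
equal to 1 satisfies, of course, all possible regularity conditions» — r05's `reg335Zd_one` (`u = 1`, `A = 0`) at the member's cube class.
[cite: Balaban1985RegularSpaces, p.98; Balaban1985BackgroundPropagators, (3.35) p.396, Cor. 3.5 p.407 («U = 1»)] -/
theorem reg335_bgZd_one (hL : 1 ≤ L) (x : MemberZd d L) {c α₀ : ℝ} (hc : 0 < c) (hM : 0 < x.M) (hα : 0 < α₀) :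
    (bgZd 𝔸 L x).Reg335 c α₀ (bgZd 𝔸 L x).one :=
  reg335Zd_one x.i.hη hL _ (by positivity)

omit [Nontrivial 𝔸] in
/-- **NON-DEGENERACY (∀-form)**: a configuration in the class (3.35) of a member whose cube class is inhabited forces `0 < c·M·α₀` — the printed bounds
`|A| < O(1)Mα₀(Lʲη)⁻¹` are STRICT, so no configuration at all is regular with a non-positive constant (the class is not `True`; `d ≥ 1`, `L ≥ 1`).
[cite: Balaban1985BackgroundPropagators, (3.35) p.396] -/
theorem pos_of_reg335_bgZd (hd : 0 < d) (hL : 1 ≤ L) (x : MemberZd d L) {c α₀ : ℝ} {U : CfgZd d 𝔸}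
    (h : (bgZd 𝔸 L x).Reg335 c α₀ U) {q : Set (Site d) × ℕ} (hq : q ∈ cubeClass396Zd L x) : 0 < c * x.M * α₀ := by
  obtain ⟨u, A, -, -, hA, -⟩ := (reg335Zd_iff _ _ _ _ _).1 h q hq
  obtain ⟨z, hz⟩ := cubeClass396Zd_nonempty hq
  have hξ : 0 < scaleLen (L : ℝ) x.i.η q.2 := scaleLen_pos (Nat.cast_pos.2 hL) x.i.hη q.2
  have h1 : (0 : ℝ) < c * x.M * α₀ * (scaleLen (L : ℝ) x.i.η q.2)⁻¹ := (norm_nonneg _).trans_lt (hA ⟨0, hd⟩ z hz)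
  exact (mul_pos_iff_of_pos_right (inv_pos.2 hξ)).1 h1

omit [Nontrivial 𝔸] in
/-- a gauge transformation with unitary values maps unitary configurations to unitary configurations ((1.15)–(1.17) `U ↦ U^u`).
[cite: Balaban1985RegularSpaces, (1.15)–(1.17) p.78; Balaban1985BackgroundPropagators, (3.28) p.395] -/
theorem gaugeAct_mem_unitaryUnits {U : Site d → Fin d → 𝔸ˣ} (hU : ∀ x κ, U x κ ∈ unitaryUnits 𝔸) {v : Site d → 𝔸ˣ}
    (hv : ∀ x, v x ∈ unitaryUnits 𝔸) (x : Site d) (κ : Fin d) : gaugeAct v U x κ ∈ unitaryUnits 𝔸 :=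
  (unitaryUnits 𝔸).mul_mem ((unitaryUnits 𝔸).mul_mem (hv x) (hU x κ)) ((unitaryUnits 𝔸).inv_mem (hv _))

/-- **THE CLASS (3.35) OF A MEMBER IS GAUGE INVARIANT** («U^u = e^{iηA}» is a statement about the orbit): n16-b's `reg335Zd_gaugeAct` at the frame — the
gauge-transformed configuration `U^v = gaugeAct v U` (a configuration of the member by `gaugeAct_mem_unitaryUnits`) is regular with the same constants.
[cite: Balaban1985BackgroundPropagators, (3.35) p.396, (3.28) p.395, p.398 («All these inequalities are invariant with respect to gauge transformations of U»)] -/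
theorem reg335_bgZd_gaugeAct (x : MemberZd d L) {c α₀ : ℝ} {U : CfgZd d 𝔸} (h : (bgZd 𝔸 L x).Reg335 c α₀ U)
    (v : Site d → 𝔸ˣ) (hv : ∀ x, v x ∈ unitaryUnits 𝔸) :
    (bgZd 𝔸 L x).Reg335 c α₀ (⟨gaugeAct v U.1, gaugeAct_mem_unitaryUnits U.2 hv⟩ : CfgZd d 𝔸) :=
  reg335Zd_gaugeAct h fun z => unitaryUnits_le_U1 (hv z)

omit [Nontrivial 𝔸] in
/-- **THE CUBE CLASS CONTAINS THE BIG BLOCKS (∀-form non-degeneracy)**: every big `j`-block (`j ≤ m`) with corner on the big-block grid, all of whose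
sites lie in `Bʲ(Λ_j) = Ω_j∖Ω_{j+1}` of the truncated member, is a class cube of index `j` (`n = 1`) — so the class is inhabited wherever the member
has a big block of level-`j` territory (`M > 0`, `L ≥ 1`). [cite: Balaban1985BackgroundPropagators, p.396 (the cube class contains the big blocks of Bʲ(Λ_j))] -/
theorem bigBlock_mem_cubeClass396Zd (hL : 1 ≤ L) (x : MemberZd d L) (hM : 0 < x.M) {j : ℕ} (hj : j ≤ x.m) (c : Site d)
    (hc : ∀ μ, (bigSideZd x.M L j : ℤ) ∣ c μ) (hsub : boxZd c (bigSideZd x.M L j) ⊆ x.i.Ω j)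
    (hlev : ∀ z ∈ boxZd c (bigSideZd x.M L j), z ∉ OmTrunc x (j + 1)) :
    (boxZd c (bigSideZd x.M L j), j) ∈ cubeClass396Zd L x := by
  have hpos : 0 < bigSideZd x.M L j := Nat.mul_pos (Nat.ceil_pos.2 hM) (pow_pos hL j)
  refine ⟨hj, ⟨c, 1, le_rfl, by norm_num, hc, by rw [one_mul]⟩, ?_, ?_, ?_⟩
  · rw [omTrunc_of_le x hj]
    exact hsub
  · exact Set.disjoint_left.2 fun z hz hz2 => hlev z hz (omTrunc_succ_subset x (j + 1) hz2)
  · exact ⟨c, mem_boxZd_self c hpos, hlev c (mem_boxZd_self c hpos)⟩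

omit [Nontrivial 𝔸] in
/-- **THE (3.35) FIELD OF THE FRAME AT THE JUNCTION'S MEMBER IS THE SECOND CLAUSE OF B8 (1.33)** in r05's typed form: «U₀ ∈ 𝔄_k({Ω_j}, α₀), U₀ satisfies
the regularity condition (3.35) in [4]» (`B8Eq133Hypotheses.Hyp133` at the truncation `m`, cube class `cubeClass396Zd`, constant `c·M·α₀`) gives the
member's class. [cite: Balaban1985RegularSpaces, (1.33) p.82; Balaban1985BackgroundPropagators, (3.35) p.396] -/
theorem reg335_bgZd_of_hyp133 (M : ℝ) (i : ZdIdx d L) (m : ℕ) {c α₀ α : ℝ} {U₀ : Site d → Fin d → 𝔸ˣ}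
    (hU₀ : ∀ x κ, U₀ x κ ∈ unitaryUnits 𝔸)
    (h : B8Eq133Hypotheses.Hyp133 L m i.η α i.Ω (cubeClass396Zd L (memZd M i m)) (c * M * α₀) U₀) :
    (bgZd 𝔸 L (memZd M i m)).Reg335 c α₀ (ιCfgZd 𝔸 L M i m U₀ hU₀) :=
  h.2

end Genuine

/-! ## §2b The node sentence at the instance and its print-strength sub-index (HONEST SCOPE (b) of the frame) -/

section SubIndex

omit [CStarAlgebra 𝔸] in
/-- **[4] THEOREM 3.3 AS A HYPOTHESIS IS MONOTONE IN THE INDEX**: the sentence over a family restricts to any re-indexed sub-family (same constants).  Hence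
the node sentence at the FULL `ℤᵈ` index implies it at print's admissible sub-index — and NOT conversely: a consumer holding only print's theorem (members
with [B6] (2.1)–(2.4)) cannot feed the junction over all `i : ZdIdx` (the located gap (b)). [cite: Balaban1985BackgroundPropagators, Thm 3.3 p.399, p.399 («the constants in the above theorems depend on d, L only»)] -/
theorem thm33Printed_comap {I J : Type} {c35 : ℝ} {geo : I → B9.Geometry} {bg : I → B9.Backgrounds}
    {Gp GA : ∀ i, B9.KernelFamily (geo i) (bg i)} (h : B9.Thm33Printed c35 geo bg Gp GA) (f : J → I) :
    B9.Thm33Printed c35 (fun j => geo (f j)) (fun j => bg (f j)) (fun j => Gp (f j)) (fun j => GA (f j)) := by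
  obtain ⟨M₁, δ₀, a₀, B₀, Bβ, Bε, Bεβ, h1, h2, h3, h4, H⟩ := h
  exact ⟨M₁, δ₀, a₀, B₀, Bβ, Bε, Bεβ, h1, h2, h3, h4, fun j => H (f j)⟩

/-- **THE NODE SENTENCE (γ) AT THE `ℤᵈ` INSTANCE IMPLIES ITS PRINT-STRENGTH RESTRICTION** to the members separated as in [B6] (2.2) (`Sep22Zd R`), for
every `R` — the direction that holds; the junction needs the full-index sentence. [cite: Balaban1985BackgroundPropagators, Thm 3.3 p.399; Balaban1984PropagatorsII, (2.2) p.224] -/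
theorem thm33_zd_sep22 {c35 : ℝ} {len : Site d → ℝ} {ops : ℝ → ZdIdx d L → ℕ → OpsZd d 𝔸}
    {loc : ∀ x : MemberZd d L, LocalLettersZd 𝔸 L x} {Gp : ∀ x : MemberZd d L, B9.KernelFamily (geoZd 𝔸 L len x) (bgZd 𝔸 L x)}
    (h33 : B9.Thm33Printed c35 (geoZd 𝔸 L len) (bgZd 𝔸 L) Gp (GAZdFam 𝔸 L len ops loc)) (R : ℕ) :
    B9.Thm33Printed c35 (fun x : {x : MemberZd d L // Sep22Zd R x} => geoZd 𝔸 L len x.1) (fun x => bgZd 𝔸 L x.1)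
      (fun x => Gp x.1) (fun x => GAZdFam 𝔸 L len ops loc x.1) :=
  thm33Printed_comap h33 Subtype.val

end SubIndex

/-! ## §3 The junction J-N06→N05 at the instance: Theorem 3.3 by name supplies the b9 socket -/

section Junction

/-- **B8 PROP. 6 IN [4]'s SHAPE, READ AT THE FRAME** (what the binder `Prop6Feed` says here, in r05's letters): for `M ≥ M₃`, `0 < α₀`, `Mα₀ ≤ c₆` and a
unitary `U₀ ∈ 𝔄_m({Ω_j}, α₀)` (`B8Ineq132.InAk` at the truncation `m`), `U₀` is in r05's transported class (3.35) at the member's cube class with the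
constant `c35·M·(K₆α₀)`. [cite: Balaban1985RegularSpaces, Prop. 6 (1.136) p.99, p.83 (after (1.35)); Balaban1985BackgroundPropagators, (3.35) p.396] -/
theorem prop6Feed_zd_iff (c35 M₃ c₆ K₆ : ℝ) :
    Prop6Feed (bgZd (d := d) 𝔸 L) L memZd (ιCfgZd 𝔸 L) c35 M₃ c₆ K₆ ↔
      ∀ (M : ℝ) (i : ZdIdx d L) (m : ℕ), M₃ ≤ M →
        ∀ (α₀ : ℝ) (U₀ : Site d → Fin d → 𝔸ˣ), (∀ x κ, U₀ x κ ∈ unitaryUnits 𝔸) →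
          0 < α₀ → M * α₀ ≤ c₆ → InAk L m i.η α₀ i.Ω U₀ →
            Reg335Zd i.η L (cubeClass396Zd L (memZd M i m)) (c35 * M * (K₆ * α₀)) U₀ :=
  Iff.rfl

variable [Nontrivial 𝔸]

/-- **THEOREM 3.3 BY NAME AT THE `ℤᵈ` INSTANCE SUPPLIES THE IN-EDGE b9 OF [B8] AT ALL LEVELS** — n06-b's `sockB9P3_allLevels_of_thm33` at the frame
`geoZd ∕ bgZd ∕ GAZdFam` with its dictionary hypothesis DISCHARGED by `dictGlob_zd`: from `B9.Thm33Printed c35 (geoZd 𝔸 L len) (bgZd 𝔸 L) Gp (GAZdFam …)`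
(N06's node sentence (γ) at this instance), B8 Prop. 6 in [4]'s shape (`Prop6Feed`), and the operator binders of [4] Sect. A at the letters `ops` ((3.27)
`InvOnSupp`, (3.69) `CurvSmall`, (3.20)–(3.21)∕(1.42) `LandauKills`, (3.16)∕(1.56) `AvgBound`, Prop. 3's global Hölder norm `HolderGlob`), the consumer's
target «`∃ B₀ B₀β cP, 0 < B₀ ∧ 0 ≤ B₀β ∧ 0 < cP ∧ ∀ i : ZdIdx d L, ∀ m ≤ i.k, SockB9P3 L B₀ B₀β cP β len i.η m i.Ω i.Λs i.Λb`» (dag-n05-a's `SB9all` of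
`B8LeafKnitZd3B9All`, read by `B8LeafSocketsB9.sockB9P3_of_allLevels ∕ sockH59_of_allLevels`). [cite: Balaban1985RegularSpaces, (1.58)–(1.59) p.86, Prop. 3 p.87, Prop. 6 p.99; Balaban1985BackgroundPropagators, Thm 3.3 p.399, (3.26)–(3.27) p.395, (3.47) p.398, (3.69) p.404] -/
theorem sockB9P3_allLevels_of_thm33_zd (hd2 : 2 ≤ d) (hL : 1 ≤ L) {c35 c₆ K₆ M₃ a₃ c69 q CH β : ℝ} {len : Site d → ℝ}
    {ops : ℝ → ZdIdx d L → ℕ → OpsZd d 𝔸} {loc : ∀ x : MemberZd d L, LocalLettersZd 𝔸 L x}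
    {Gp : ∀ x : MemberZd d L, B9.KernelFamily (geoZd 𝔸 L len x) (bgZd 𝔸 L x)}
    (h33 : B9.Thm33Printed c35 (geoZd 𝔸 L len) (bgZd 𝔸 L) Gp (GAZdFam 𝔸 L len ops loc))
    (hP6 : Prop6Feed (bgZd (d := d) 𝔸 L) L memZd (ιCfgZd 𝔸 L) c35 M₃ c₆ K₆)
    (hinv : InvOnSupp (bgZd 𝔸 L) L memZd (ιCfgZd 𝔸 L) ops c35 M₃ a₃)
    (hcurv : CurvSmall (bgZd 𝔸 L) L memZd (ιCfgZd 𝔸 L) ops c35 M₃ a₃ c69)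
    (hlan : LandauKills (bgZd 𝔸 L) L memZd (ιCfgZd 𝔸 L) ops c35 M₃ a₃) (havg : AvgBound L ops q)
    (hhol : HolderGlob (geoZd 𝔸 L len) (bgZd 𝔸 L) (GAZdFam 𝔸 L len ops loc) L memZd (ιCfgZd 𝔸 L) ops β len CH)
    (hc₆ : 0 < c₆) (hK₆ : 0 < K₆) (ha₃ : 0 < a₃) (hc69 : 0 ≤ c69) (hq : 0 ≤ q) :
    ∃ B₀ B₀β cP : ℝ, 0 < B₀ ∧ 0 ≤ B₀β ∧ 0 < cP ∧
      ∀ (i : ZdIdx d L) (m : ℕ), m ≤ i.k → SockB9P3 (𝔸 := 𝔸) L B₀ B₀β cP β len i.η m i.Ω i.Λs i.Λb :=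
  sockB9P3_allLevels_of_thm33 (geoZd 𝔸 L len) (bgZd 𝔸 L) (GAZdFam 𝔸 L len ops loc) L memZd (ιCfgZd 𝔸 L) (ιLocZd 𝔸 L len) ops
    hd2 hL h33 (dictGlob_zd len ops loc) hP6 hinv hcurv hlan havg hhol hc₆ hK₆ ha₃ hc69 hq

end Junction

#print axioms dictGlob_zd
#print axioms sockB9P3_allLevels_of_thm33_zd

/-! ## §4 (v1.1, append-only) The class (3.35) of the frame contains CURVED backgrounds: n16-b's two-radii criterion at the members -/

section Curved

open B7Prop1Explicit (hol plaqWord l1)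
open B9Eq335AxialCriterion (reg335Zd_of_plaq_radii)

/-- the `ℓ¹`-radius of a cube about its corner: `z ∈ boxZd c s ⇒ |z − c|₁ ≤ d·s` («a box of side r lattice units has ℓ¹-radius ≤ d·r about its
corner», `B9Eq335AxialCriterion` §6). [cite: Balaban1985BackgroundPropagators, p.396 («its size in the lattice T_η is O(1)MLʲη»)] -/
theorem l1_sub_le_of_mem_boxZd {c z : Site d} {s : ℕ} (hz : z ∈ boxZd c s) : l1 (z - c) ≤ d * s := by
  unfold l1
  calc ∑ κ, ((z - c) κ).natAbs ≤ ∑ _κ : Fin d, s := Finset.sum_le_sum fun κ _ => ?_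
    _ = d * s := by simp
  have h := hz κ
  simp only [Pi.sub_apply]
  omega

/-- every cube of the member's class lies in the `ℓ¹`-ball of radius `10·d·⌈M⌉₊·Lʲ` about its corner and has scale `Lʲη ≤ Lᵐη` — the family condition
of n16-b's `reg335Zd_of_plaq_radii` at the member (`Lᵐη ≤ 1`). [cite: Balaban1985BackgroundPropagators, p.396 (the cube class: size ≤ 10MLʲη)] -/
theorem cubeClass396Zd_family (hL : 1 ≤ L) (x : MemberZd d L) (hsc : (L : ℝ) ^ x.m * x.i.η ≤ 1)
    {q : Set (Site d) × ℕ} (hq : q ∈ cubeClass396Zd L x) :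
    (L : ℝ) ^ q.2 * x.i.η ≤ 1 ∧ ∃ y : Site d, ∀ z ∈ q.1, (l1 (z - y) : ℝ) ≤ (10 * d * ⌈x.M⌉₊ : ℝ) * (L : ℝ) ^ q.2 := by
  obtain ⟨hj, ⟨c, n, -, hn10, -, hQ⟩, -⟩ := hq
  have hL1 : (1 : ℝ) ≤ (L : ℝ) := by exact_mod_cast hL
  refine ⟨?_, c, fun z hz => ?_⟩
  · exact (mul_le_mul_of_nonneg_right (pow_le_pow_right₀ hL1 hj) x.i.hη.le).trans hsc
  · rw [hQ] at hz
    have h1 : (l1 (z - c) : ℝ) ≤ (d : ℝ) * ((n * bigSideZd x.M L q.2 : ℕ) : ℝ) := by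
      exact_mod_cast l1_sub_le_of_mem_boxZd hz
    have hn : (n : ℝ) ≤ 10 := by exact_mod_cast hn10
    have hB : (0 : ℝ) ≤ (⌈x.M⌉₊ : ℝ) * (L : ℝ) ^ q.2 := by positivity
    refine h1.trans ?_
    unfold bigSideZd
    push_cast
    have h2 : (d : ℝ) * ((n : ℝ) * ((⌈x.M⌉₊ : ℝ) * (L : ℝ) ^ q.2)) ≤ (d : ℝ) * (10 * ((⌈x.M⌉₊ : ℝ) * (L : ℝ) ^ q.2)) :=
      mul_le_mul_of_nonneg_left (mul_le_mul_of_nonneg_right hn hB) (Nat.cast_nonneg d)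
    linarith

variable [Nontrivial 𝔸]

/-- **NON-VACUITY BY CURVED BACKGROUNDS — the class (3.35) of a member contains every unitary configuration of SMALL CURVATURE** (n16-b's elementary
two-radii criterion `B9Eq335AxialCriterion.reg335Zd_of_plaq_radii` at the frame, NOT print's derivation via B8 Prop. 6 ∕ Thm 4): if the plaquette
variables of a unitary `V` are within `α₀η²` of `1` and its transported plaquette differences are `≤ c₀η³`, then at every member `x = (M, i, m)` with
`η ≤ 1`, `Lᵐη ≤ 1` (print: `η = L^{−k}`, `m ≤ k`) `V` is in `(bgZd 𝔸 L x).Reg335 c α` as soon as `c·M·α > 2(M′+1)α₀ + 2M′c₀ + 4M′(1+2M′)α₀²`, `M′ =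
10·d·⌈M⌉₊`, `(M′+1)α₀ ≤ ½`.  So `B9.Thm33Printed` AT THE INSTANCE quantifies over a hypothesis class holding genuinely curved `U₀`, not only the gauge
orbit of `1`. [cite: Balaban1985BackgroundPropagators, (3.35) p.396; Balaban1985RegularSpaces, (1.33) p.82, p.99; Balaban1985Averaging, pp.24–25] -/
theorem reg335_bgZd_of_plaq_radii (hL : 1 ≤ L) (x : MemberZd d L) (hη1 : x.i.η ≤ 1) (hsc : (L : ℝ) ^ x.m * x.i.η ≤ 1)
    {V : Site d → Fin d → 𝔸ˣ} (hV : ∀ z κ, V z κ ∈ unitaryUnits 𝔸) {α₀ c₀ : ℝ} (hα₀ : 0 ≤ α₀) (hc₀ : 0 ≤ c₀)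
    (hsmall : ((10 * d * ⌈x.M⌉₊ : ℝ) + 1) * α₀ ≤ 1 / 2)
    (h44 : ∀ (z : Site d) (κ μ : Fin d), κ ≠ μ → ‖((hol V z (plaqWord κ μ) : 𝔸ˣ) : 𝔸) - 1‖ ≤ α₀ * x.i.η ^ 2)
    (hG : ∀ (p : Site d) (ν κ μ : Fin d), κ ≠ μ →
      ‖(V p ν : 𝔸) * ((hol V (p + e ν) (plaqWord κ μ) : 𝔸ˣ) : 𝔸) * (((V p ν)⁻¹ : 𝔸ˣ) : 𝔸)
        - ((hol V p (plaqWord κ μ) : 𝔸ˣ) : 𝔸)‖ ≤ c₀ * x.i.η ^ 3)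
    {c α : ℝ}
    (hC : 2 * ((10 * d * ⌈x.M⌉₊ : ℝ) + 1) * α₀ + 2 * (10 * d * ⌈x.M⌉₊ : ℝ) * c₀ +
      4 * (10 * d * ⌈x.M⌉₊ : ℝ) * (1 + 2 * (10 * d * ⌈x.M⌉₊ : ℝ)) * α₀ ^ 2 < c * x.M * α) :
    (bgZd 𝔸 L x).Reg335 c α (⟨V, hV⟩ : CfgZd d 𝔸) :=
  reg335Zd_of_plaq_radii (fun z κ => unitaryUnits_le_U1 (hV z κ)) x.i.hη hη1 hL hα₀ hc₀ (by positivity) hsmall h44 hG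
    (fun _ hq => cubeClass396Zd_family hL x hsc hq) hC

end Curved

end Literature.MathematicalPhysics.QuantumFieldTheory.Balaban1983to89.B9SupplySockB9P3ZdInstance

end
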